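import Summits.Ventures.CertifiedManyBodySolver.Theorems.TcThermcert1VertexDefs
import HarnessLib

/-!
# Theorems landing (definitions; helper toward stmt-Ventures-26382; cell lead R149 (a)) — route «hubbard-tc-thermcert-1», crux K2
# `TcThermcert1.ThermalStiffnessCeilingBoxb10_le_9o71`, line «vertex»: the `β` ∕ level ∕ sub-box-GENERIC OBJECTS of the rung sockets

This is §1 of the crux workfile `Cruxes/ThermalStiffnessCeilingBoxb10_le_9o71/VertexRungSockets.lean` v5.2 (hub-tc-therm-plan-2, agent
planner-hub-tc-therm-plan-2-g0-0, 2026-08-28; sha16 f76a9305a8770058, commit ce24a896f442; farm rc 0 ∕ 0 sorries; leg hubbard-tc-ref VERDICTS §439 R436 CLEAN;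
read-back hub-tc-therm-crit-2 g1 CLEAN, tc INBOX l.1866), landed VERBATIM — declarations byte-identical, namespace re-pointed to
`…Theorems.TcThermcert1.VertexRungs` — by hubbard-tc-mod-3 g11 on the lead's SUMMONS (tc INBOX l.1862). The workfile (405 lines) exceeds the gate's 400-line limit
for Theorems files with proofs, so it lands as TWO modules sharing ONE namespace (every fully-qualified name is the planned one): this DEFINITIONS file (§1:
`lagrAt`, `RectCertAt`, `LagrAffineAt`, `VertexCoverBoxAt`, `TrialGeneratorCertificateBoxAt`, with the `rfl` ∕ `↔` consistency lemmas `lagrAt_ten`, `rectCertAt_ten`,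
`vertexCoverBoxB10_iff`; imports `Theorems.TcThermcert1VertexDefs` only — no route file in its cone) and `Theorems/TcThermcert1VertexRungSockets.lean` (§2–§5: bookkeeping,
composition, cover algebra, rungs `rungBox_b6` ∕ `rungBox_b5` ∕ `rungBox_b8`, K2 instance by name).

HONEST FRAMING: every `VertexCoverBoxAt β q U₁ U₂` (like the registered S4 `VertexCoverBoxB10`, which is literally its `(10, 9/71, 79/10, 147/10)` instance) and every
`TrialGeneratorCertificateBoxAt …` is a finite frozen-dual certificate STATEMENT that is proved NOWHERE today — the producers' object; nothing about the Hubbard model is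
proved in this file; no certificate, no number of record, no kelvin value and no `T_c` lives here; KT ceilings never assert superconductivity; NO lower bound on `T_c`
is claimed; no summit, rung or crux statement is proved by this seat; the registered skeleton `Lines/vertex.lean` v4.2 (55c235d25eb4162b) is NOT touched.

References: WangEtAl2024 §III (frozen-dual ∕ corner certificates); DLS1978 §2 eqs. (22′), (27), (28); HazraVermaRanderia2019 eqs. (2)–(4).
-/

noncomputable section

namespace Summit.Ventures.CertifiedManyBodySolver.Theorems.TcThermcert1.VertexRungs

open Filter Topology Matrix Finset
open Literature.MathematicalPhysics.QuantumLattice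
open Literature.MathematicalPhysics.QuantumLattice.ThermodynamicLimit
open Literature.MathematicalPhysics.QuantumFieldTheory
open Literature.MathematicalPhysics.StatisticalMechanics
open Literature.Probability.LatticeModels
open Summit.Ventures.CertifiedManyBodySolver.Observables
open Summit.Ventures.CertifiedManyBodySolver.Theorems.TcThermcert1
open Summit.Ventures.CertifiedManyBodySolver.Theorems.TcThermcert1.Vertex
open scoped ComplexConjugate ComplexOrder

/-! ## §1 The `β`-generic objects (at `β = 10` they ARE the registered ones) -/

/-- **The frozen-dual Lagrangian at inverse temperature `β`** (`t = 1`, `t′ = 0`, density `7/8` carried by the rows):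
`L_d^β(U, μ₀; ω) = Re ω(W_a(U)) + Σ_st Re(y·ω(st(U,μ₀))) + Σ_eeb y·Re ω(eeb_β(U,μ₀)) + Σ_bog y·Re ω(bog_β(U))` — `CertDatum.lagr` with the
hard-wired `10` replaced by `β`. [cite: WangEtAl2024, §III] -/
def lagrAt (β : ℝ) (d : CertDatum) (U μ₀ : ℝ) (ω : InfVolFermionState 2) : ℝ :=
  (ω.expect (box 2 (3 * d.r + 2)) (trialWord 0 U d.r d.a)).re +
    (d.st.map fun ρ => (ρ.y * ω.expect ρ.Λ' (stWord 0 U μ₀ ρ.hΛ ρ.A)).re).sum +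
    (d.eeb.map fun ρ => ρ.y * (ω.expect ρ.Λ' (eebWord β 0 U μ₀ ρ.hΛ ρ.A ρ.s ρ.q)).re).sum +
    (d.bog.map fun ρ => ρ.y * (ω.expect ρ.Λ' (bogWord β 0 U ρ.hΛ ρ.A ρ.C)).re).sum

/-- At `β = 10` the generic Lagrangian IS the registered one. [cite: WangEtAl2024, §III] -/
theorem lagrAt_ten (d : CertDatum) : lagrAt 10 d = d.lagr := rfl

/-- **Corner certificates at `β`** of the datum `d` on the cell `[U₁, U₂] × [μ₁, μ₂]` at level `c`, for every translation-invariant state of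
density `7/8` (`CertDatum.RectCert` with `lagr` replaced by `lagrAt β`). [cite: WangEtAl2024, §III] -/
def RectCertAt (β : ℝ) (d : CertDatum) (U₁ U₂ μ₁ μ₂ c : ℝ) : Prop :=
  ∀ ω : InfVolFermionState 2, ω.IsTranslationInvariant → ω.density = 7 / 8 →
    lagrAt β d U₁ μ₁ ω ≤ c ∧ lagrAt β d U₁ μ₂ ω ≤ c ∧ lagrAt β d U₂ μ₁ ω ≤ c ∧ lagrAt β d U₂ μ₂ ω ≤ c

/-- At `β = 10` the generic corner certificates ARE the registered ones. [cite: WangEtAl2024, §III] -/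
theorem rectCertAt_ten (d : CertDatum) : RectCertAt 10 d = d.RectCert := rfl

/-- Joint affinity in `(U, μ₀)` of the generic Lagrangian (`CertDatum.LagrAffine` at `β`). [cite: WangEtAl2024, §III] -/
def LagrAffineAt (β : ℝ) (d : CertDatum) : Prop :=
  ∀ (p₁ p₂ q₁ q₂ θ : ℝ) (ω : InfVolFermionState 2),
    lagrAt β d ((1 - θ) * p₁ + θ * q₁) ((1 - θ) * p₂ + θ * q₂) ω = (1 - θ) * lagrAt β d p₁ p₂ ω + θ * lagrAt β d q₁ q₂ ω

/-- **The generic cell-cover statement** at `(β, q)` on the sub-box `[U₁, U₂]`: a finite cover of the banded SUPPORTING set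
`{(U, μ₀) : U ∈ [U₁, U₂], μ₀ ∈ band_β(U), μ₀ supporting for p(β; 1, 0, U; ·) at 7/8}` by rational cells, each carrying ONE frozen certificate
datum whose four corner certificates hold at level `q`. The registered S4 `VertexCoverBoxB10` is the instance `(10, 9/71, 79/10, 147/10)`
(`vertexCoverBoxB10_iff`). NOT proved anywhere today for any `(β, q)`; the producers' object. [cite: WangEtAl2024, §III] -/
def VertexCoverBoxAt (β : ℝ) (q : ℚ) (U₁ U₂ : ℝ) : Prop :=
  ∃ S : Finset ((ℚ × ℚ) × (ℚ × ℚ)),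
    (∀ U μ₀ : ℝ, U₁ ≤ U → U ≤ U₂ → InMuBand β 1 0 U (7 / 8) μ₀ → IsSupportingMu β 1 0 U (7 / 8) μ₀ →
      ∃ c ∈ S, ((c.1.1 : ℚ) : ℝ) ≤ U ∧ U ≤ ((c.1.2 : ℚ) : ℝ) ∧ ((c.2.1 : ℚ) : ℝ) ≤ μ₀ ∧ μ₀ ≤ ((c.2.2 : ℚ) : ℝ)) ∧
      ∀ c ∈ S, ∃ d : CertDatum,
        RectCertAt β d ((c.1.1 : ℚ) : ℝ) ((c.1.2 : ℚ) : ℝ) ((c.2.1 : ℚ) : ℝ) ((c.2.2 : ℚ) : ℝ) ((q : ℚ) : ℝ)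

/-- **The generic sub-box certificate statement** at `(β, q)` on `[U₁, U₂]` (the opener's `TrialGeneratorCertificateBoxB10` is the instance
`(10, 9/71, 79/10, 147/10)` up to the cast of the level). [cite: DLS1978, §2 eqs. (27), (28)] -/
def TrialGeneratorCertificateBoxAt (β : ℝ) (q : ℚ) (U₁ U₂ : ℝ) : Prop :=
  ∀ U : ℝ, U₁ ≤ U → U ≤ U₂ → ∀ μ₀ : ℝ, InMuBand β 1 0 U (7 / 8) μ₀ → IsSupportingMu β 1 0 U (7 / 8) μ₀ →
    ∃ (r : ℕ) (a : FermionOp (box 2 r)), IsTrialGenerator r a ∧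
      ∀ ω : InfVolFermionState 2, IsThermalRowState β 0 U (7 / 8) μ₀ ω →
        (ω.expect (box 2 (3 * r + 2)) (trialWord 0 U r a)).re ≤ ((q : ℚ) : ℝ)

/-- The registered S4 statement is literally the `(β, q, box) = (10, 9/71, [79/10, 147/10])` instance of the generic cover statement.
[cite: WangEtAl2024, §III] -/
theorem vertexCoverBoxB10_iff : VertexCoverBoxB10 ↔ VertexCoverBoxAt 10 (9 / 71) (79 / 10) (147 / 10) := by
  have h971 : (((9 / 71 : ℚ)) : ℝ) = 9 / 71 := by push_cast; norm_num
  unfold VertexCoverBoxB10 VertexCoverBoxAt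
  simp only [rectCertAt_ten, h971]

end Summit.Ventures.CertifiedManyBodySolver.Theorems.TcThermcert1.VertexRungs
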